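import Literature.MathematicalPhysics.QuantumFieldTheory.Balaban1983to89.B9Thm313WholeCutLettersGXHAtPinsP
import Literature.MathematicalPhysics.QuantumFieldTheory.Balaban1983to89.B9Thm313WholeCutLettersAtPinsT
import Literature.MathematicalPhysics.QuantumFieldTheory.Balaban1983to89.B9SmoothHolderClassPReadings

/-!
# `Balaban1983to89.B9Thm313WholeCutLettersAtPinsP` — [B9] Theorem 3.13 (p. 426): the re-cut letters' WHOLE free-class content AT THE PRINT-WEIGHTED BOND PIN (P1′)
# `bXH := bHZKPG (taxiB U) w` (`B9SmoothHolderClassP`) — `Letters313Zc.wGp`, the probe letter `pWE` (the certificate's `hWE`) and the full record `Letters313Zc`,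
# from `Letters313Z` plus PRINT-LITERAL (3.44)∕(3.45) members for G′ at `bHZKP (taxiB U) s` — the (A′) twin of `…CutLettersAtPinsT` (LOCATED-U6 repair)

T. Bałaban, *Propagators for lattice gauge theories in a background field*, Commun. Math. Phys. **99** (1985) 389–434
[`Balaban1985BackgroundPropagators`, "B9"]; [4] = T. Bałaban, *Propagators and renormalization transformations for lattice gauge
theories. II*, Commun. Math. Phys. **96** (1984) 223–250 [`Balaban1984PropagatorsII`].

statement-level skeleton of published theorems with citation tags; proofs where landed; nothing here is a claim about the
Yang–Mills mass gap

THE PRINTED LOCI.  [B9] Thm 3.13 p. 426 + (3.152)–(3.153), Thm 3.1 (3.42)–(3.45) pp. 397–398 (the (3.44)∕(3.45) input functional `‖λ‖^{ξ′}_ε + |λ|` — a unit member of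
`bHZKP … s` has it `≤ 2·Lʲ′η`), (3.49) p. 399; [4] (2.51)–(2.56) pp. 232–233, Lemma 2.1 (2.60)–(2.61) p. 234.

WHY THIS FILE (cell `pub-ymgap`, node N06, seat dag-n06-l g24; n06-d g16 WORD-U6 = (A′) GO, INBOX 2026-08-29T01:09Z: ED.63∕64 need the P-twin of `pWE_bHZKG_of_pins`,
ED.65+ the P-twins of `wGp_bHZKG_of_pins` and `letters313Zc_bHZKG_of_pins`).  The g22 T-versions read their (3.44)∕(3.45) inputs `h44 ∕ hp45` at `bHZKT (taxiB U) s 1`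
with targets `cNorm blk 1 ∕ cNormR blkPX (β−1)` — the ✗ rows of LOCATED-U6 (dimension-1 claims from a source certifying oscillation-dimension `s`).  HERE the SAME
binder text reads them at the print-weighted member `bHZKP (taxiB U) s` (source certifies dimension 1: (3.44)∕(3.45) LITERALLY), the class embedding `hX` is
`B9SmoothHolderClassPReadings.hasMaj_id_bHZKPG_cNorm`, the projection is `hasMaj_from_bHZKPG`, and `gXH` is `…GXHAtPinsP.gXH_bHZKPG_of_pins`.  The g19 engines
`wGp_of_h44Gp ∕ pWE_of_p45Gp ∕ Letters313Zc.of_Z` are class-agnostic and serve verbatim.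
* §0 `hX_bHZKPG_blk`; §1 ★★ `wGp_bHZKPG_of_pins`; §2 ★★ `pWE_bHZKPG_of_pins` (= the certificate's `hWE` at (P1′)); §3 ★★ `letters313Zc_bHZKPG_of_pins` (= `hletters13` at (P1′)).
HONEST SCOPE.  Kernel bookkeeping over landed modules; every input is a HYPOTHESIS of printed species; nothing of [B9]∕[4] asserted; no certificate edit; COUNT-NEUTRAL;
N06 NOT discharged; nothing continuum, nothing about the mass gap.  Cell `pub-ymgap` (HUMAN RULING D-0062), Track A node N06 [B9], seat `pub-ymgap-dag-n06-l` (g24), 2026-08-29.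
-/

namespace Literature.MathematicalPhysics.QuantumFieldTheory.Balaban1983to89.B9Thm313WholeCutLettersAtPinsP

open Finset B6RandomWalk B6RandomWalkHom B9Thm34Ext B11SectG B9SectDSup B9SectDL2Decay B9Thm37Glue B9Thm312Whole
open B9Thm312WholeClasses B9RWSums343to347Whole B9RWSums343Holder B9PerturbationMajorantAlgebra B9PerturbationMajorantLetters
open B9Thm313WholeRgdFrom3152 B9Thm312WholeLeaf B9Thm312WholeHolder B9Thm313WholeHolder B9Thm313Whole B9Thm313WholeZ B9Thm313WholeLettersCut
open B9Thm313WholeCutLettersSupFrom344 B9Thm313WholeCutLettersGXHAtPinsT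
open B6GlobalChartV1 (PV blkV1)
open B6Ineq2142KLevelV1 (β lvl)
open B6KLevelCensusIndexV1 (KIdx)
open B6Geom246MultiLevelTorus (geomT)
open B9GeoNormsKLevelV1 (geo9K)
open B9CoReadingCoords (XBK blkBK)
open B9CoReadingCoordsHolder (PK blkPK probeK wK w₀K)
open B9CoReadingCoordsHolderAdm (wKA)
open B9MultiscaleSmoothPartitionYNear (rNear dist_sIK_le_of_nearY)
open B9SmoothHolderClassT (bHZKT)
open B9SmoothHolderClassP (bHZKP bHZKPG hasMaj_from_bHZKPG)
open B9SmoothHolderClassPReadings (hasMaj_id_bHZKPG_cNorm)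
open B9Thm313WholeCutLettersGXHAtPinsP (gXH_bHZKPG_of_pins)
open B9SmoothHolderClassTClosure (abs_cf_eq_nKT)
open Node00 (SiteY FBondY IBondY toKT)

noncomputable section

variable {d ℓ : ℕ} {hd : 1 ≤ d + 1} {hL : Odd (ℓ + 1) ∧ 1 < ℓ + 1} {b₀ b₁ : ℝ}
variable {𝔸 : Type} [NormedRing 𝔸] [NormedAlgebra ℂ 𝔸]
variable {κ : Type} [Fintype κ]
variable (i : KIdx d ℓ hd hL b₀ b₁) [Fintype (geo9K i).Site] (b : Module.Basis κ ℝ 𝔸) (g : FBondY i → FBondY i → 𝔸ˣ)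
variable {B : B9.Backgrounds} {Y Z W PY : Type} [Fintype Y] [Fintype Z] [Fintype W]
variable {R₀ : ℝ} {H₀ : Prop}

/-! ## §0 The class embedding at the pin, read on the ops' block map -/

/-- the embedding `bHZKPG g w → 𝔠⁽¹⁾` at exponent `s` on the ops' block map (`𝔬.blk = blkBK bI`), radius by LAYER B, units by `hcfk`: constant
`(w s)⁻¹·L·e^{δ(r_near+1)}` at any rate `δ ≥ 0`. [cite: Balaban1985BackgroundPropagators, (3.41)–(3.42) p.397 + (3.44) p.398; Balaban1984PropagatorsII, (2.51)–(2.54) pp.232–233] -/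
theorem hX_bHZKPG_blk (hG : GeoOK (geo9K i)) (w : ℝ → ℝ) (hw0 : ∀ s, 0 ≤ w s) (hw1 : ∀ s, w s ≤ 1) {s : ℝ} (hs0 : 0 < s) (hs1 : s < 1) (hws : 0 < w s)
    {bI : FBondY i → IBondY i}
    (hβ1 : ∀ f : FBondY i, (geomT i.D).dist (β i.hN i.D i.hk (bI f)) (blkV1 i.hN i.D f) ≤ 1)
    (hlev : ∀ f : FBondY i, lvl i.hN i.D i.hk (bI f) = (blkV1 i.hN i.D f).1.1) (hbI0 : ∀ f : FBondY i, bI f = bI ⟨f.src, 0⟩)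
    (hcfk : i.cf = (((ℓ + 1 : ℕ) : ℝ)) ^ i.k) {blk : XBK κ i → IBondY i} (hblk : blk = blkBK i bI) {δ : ℝ} (hδ : 0 ≤ δ) :
    HasMaj (bHZKPG (κ := κ) i b g (R := R₀) (H := H₀) w hw0 hw1) (cNorm R₀ H₀ blk hG.lenle 1) LinearMap.id
      (fun y y' => (w s)⁻¹ * ((((ℓ + 1 : ℕ) : ℝ)) * Real.exp (δ * (rNear d ℓ + 1))) * Real.exp (-(δ * (geo9K i).dist y y'))) := by
  subst hblk
  exact (hasMaj_id_bHZKPG_cNorm i b g w hw0 hw1 hs0 hs1 hws hG.lenle hlev hbI0 hδ (fun _ _ h => dist_sIK_le_of_nearY i hβ1 h)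
    (abs_cf_eq_nKT i hcfk)).mono fun y y' => le_of_eq (by ring)

/-! ## §1 ★★ `Letters313Zc.wGp` at the graded print-weighted pin -/

omit [Fintype Y] [Fintype Z] in
/-- ★★ **`Letters313Zc.wGp` (D·G′·R·D\* : `bXH` → 𝔠⁽¹⁾) AT THE PIN `bXH := bHZKPG g w`** — g19's `wGp_of_h44Gp` with its class embedding `hX` DISCHARGED
(`hasMaj_id_bHZKPG_cNorm`, κ_X := `(w s)⁻¹·L·e^{(δ−αδ−σ)(r_near+1)}`) and the (3.44) member for G′ read PRINT-LITERALLY at ONE print-weighted member `bHZKP g s` and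
projected (`(w s)⁻¹`): any `B₃ ≥ ϱ((w s)⁻¹B₄₄ + B₀·C_P·L₀·κ_X·c²)`, `δ₃ ≤ δ − αδ − 2σ`.  NO class axiom. [cite: Balaban1985BackgroundPropagators, Thm 3.13 p.426 + (3.44) p.398 + Thm 3.1 (3.42) p.397 + (3.49) p.399 + (3.152)–(3.153) p.426; Balaban1984PropagatorsII, (2.51)–(2.56) pp.232–233 + Lemma 2.1 (2.60)–(2.61) p.234] -/
theorem wGp_bHZKPG_of_pins (hG : GeoOK (geo9K i)) {dF : ℕ} {δ α L₀ σ c : ℝ} (hF : Facts347 (geo9K i) R₀ H₀ dF δ α L₀)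
    (hrow : RowSum (toB6 (geo9K i) R₀ H₀) σ c) {𝔬 : Ops (geo9K i) B (XBK κ i) Y Z W} {Gp P : B.Cfg → Module.End ℝ (W → ℝ)} {U : B.Cfg}
    (w : ℝ → ℝ) (hw0 : ∀ s, 0 ≤ w s) (hw1 : ∀ s, w s ≤ 1) {s : ℝ} (hs0 : 0 < s) (hs1 : s < 1) (hws : 0 < w s)
    {bI : FBondY i → IBondY i}
    (hβ1 : ∀ f : FBondY i, (geomT i.D).dist (β i.hN i.D i.hk (bI f)) (blkV1 i.hN i.D f) ≤ 1)
    (hlev : ∀ f : FBondY i, lvl i.hN i.D i.hk (bI f) = (blkV1 i.hN i.D f).1.1) (hbI0 : ∀ f : FBondY i, bI f = bI ⟨f.src, 0⟩)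
    (hcfk : i.cf = (((ℓ + 1 : ℕ) : ℝ)) ^ i.k) (hblk : 𝔬.blk = blkBK i bI)
    {B₀ δ₀ CP δP B44 δ44 ϱ B₃ δ₃ : ℝ}
    (h31 : Thm31GpMaj 𝔬.blkW 𝔬.blk (Gp U) (𝔬.Dv U) (𝔬.Dvstar U) R₀ H₀ B₀ δ₀)
    (h49 : Proj349Maj 𝔬.blkW 𝔬.blk (P U) (𝔬.Dv U) (𝔬.Dvstar U) R₀ H₀ CP δP)
    (hR : 𝔬.R U = ϱ • (LinearMap.id - P U))
    (h44 : HasMaj (bHZKP (κ := κ) i b g (R := R₀) (H := H₀) (s := s) hs0.le hs1.le) (cNorm R₀ H₀ 𝔬.blk hG.lenle 1) (𝔬.Dv U ∘ₗ Gp U ∘ₗ 𝔬.Dvstar U)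
      (fun a b => B44 * Real.exp (-(δ44 * (geo9K i).dist a b))))
    (hϱ : 0 ≤ ϱ) (hB₀ : 0 ≤ B₀) (hCP : 0 ≤ CP) (hB44 : 0 ≤ B44) (hc : 0 ≤ c) (hσ : 0 ≤ σ) (hαδ : 0 ≤ α * δ)
    (hδ₀ : δ ≤ δ₀) (hδP : δ ≤ δP) (hbud : 0 ≤ δ - α * δ - 2 * σ) (hδ44 : δ - α * δ - 2 * σ ≤ δ44)
    (hB₃ : ϱ * ((w s)⁻¹ * B44 + B₀ * (CP * L₀) * ((w s)⁻¹ * ((((ℓ + 1 : ℕ) : ℝ)) * Real.exp ((δ - α * δ - σ) * (rNear d ℓ + 1)))) * c * c) ≤ B₃)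
    (hδ₃ : δ₃ ≤ δ - α * δ - 2 * σ) :
    HasMaj (bHZKPG (κ := κ) i b g (R := R₀) (H := H₀) w hw0 hw1) (cNorm R₀ H₀ 𝔬.blk hG.lenle 1) (𝔬.Dv U ∘ₗ Gp U ∘ₗ 𝔬.R U ∘ₗ 𝔬.Dvstar U)
      (fun a b => B₃ * Real.exp (-(δ₃ * (geo9K i).dist a b))) := by
  have hws' : 0 ≤ (w s)⁻¹ := inv_nonneg.2 (hw0 s)
  have hρ₁ : 0 ≤ δ - α * δ - σ := by linarith
  have hX := hX_bHZKPG_blk i b g (R₀ := R₀) (H₀ := H₀) hG w hw0 hw1 hs0 hs1 hws hβ1 hlev hbI0 hcfk hblk hρ₁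
  have h44' : HasMaj (bHZKPG (κ := κ) i b g (R := R₀) (H := H₀) w hw0 hw1) (cNorm R₀ H₀ 𝔬.blk hG.lenle 1) (𝔬.Dv U ∘ₗ Gp U ∘ₗ 𝔬.Dvstar U)
      (fun a b => (w s)⁻¹ * B44 * Real.exp (-(δ44 * (geo9K i).dist a b))) :=
    (hasMaj_from_bHZKPG i b g w hw0 hw1 hs0 hs1 hws (fun _ _ => mul_nonneg hB44 (Real.exp_nonneg _)) h44).mono
      fun a b => le_of_eq (by ring)
  exact wGp_of_h44Gp hG hF hrow h31 h49 hR hX h44' hϱ hB₀ hCP (by positivity) (mul_nonneg hws' hB44) hc hσ hαδ hδ₀ hδP hbud le_rfl hδ44 hB₃ hδ₃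

/-! ## §2 ★★ The probe letter `pWE` (the certificate's `hWE`) at the graded print-weighted pin -/

omit [Fintype Y] [Fintype Z] in
/-- ★★ **`Letters313HZc.pWE β` (Φ^X_β∘(D·G′·R·D\*) : `bXH` → 𝔠_P^{(β−1)}) AT THE PIN `bXH := bHZKPG g w`** — g19's `pWE_of_p45Gp` with `hX` DISCHARGED and the (3.45)
member for G′ read PRINT-LITERALLY at ONE print-weighted member `bHZKP g s` (print: `s > β`, (3.45) «‖λ‖_(β+ε)»; the knit picks `s = sch β`) and projected: any
`Bx ≥ ϱ((w s)⁻¹B₄₅ + B_h·C_P·L₀·κ_X·c²)`, `δ₃ ≤ δ − αδ − 2σ`.  NO class axiom.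
[cite: Balaban1985BackgroundPropagators, Thm 3.13 p.426 + (3.43)–(3.45) p.398 + (3.49) p.399 + (3.152)–(3.153) p.426; Balaban1984PropagatorsII, (2.51)–(2.56) pp.232–233 + Lemma 2.1 (2.60)–(2.61) p.234] -/
theorem pWE_bHZKPG_of_pins (hG : GeoOK (geo9K i)) {dF : ℕ} {δ α L₀ σ c : ℝ} (hF : Facts347 (geo9K i) R₀ H₀ dF δ α L₀)
    (hrow : RowSum (toB6 (geo9K i) R₀ H₀) σ c) {𝔬 : Ops (geo9K i) B (XBK κ i) Y Z W} {PX : Type} [Fintype PX]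
    (𝔭 : HolderProbes (geo9K i) B (XBK κ i) Y PX PY) {Gp P : B.Cfg → Module.End ℝ (W → ℝ)} {U : B.Cfg}
    (w : ℝ → ℝ) (hw0 : ∀ s, 0 ≤ w s) (hw1 : ∀ s, w s ≤ 1) {s : ℝ} (hs0 : 0 < s) (hs1 : s < 1) (hws : 0 < w s)
    {bI : FBondY i → IBondY i}
    (hβ1 : ∀ f : FBondY i, (geomT i.D).dist (β i.hN i.D i.hk (bI f)) (blkV1 i.hN i.D f) ≤ 1)
    (hlev : ∀ f : FBondY i, lvl i.hN i.D i.hk (bI f) = (blkV1 i.hN i.D f).1.1) (hbI0 : ∀ f : FBondY i, bI f = bI ⟨f.src, 0⟩)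
    (hcfk : i.cf = (((ℓ + 1 : ℕ) : ℝ)) ^ i.k) (hblk : 𝔬.blk = blkBK i bI)
    {CP δP B45 δ45 Bh δh ϱ Bx δ₃ βH : ℝ}
    (h49 : Proj349Maj 𝔬.blkW 𝔬.blk (P U) (𝔬.Dv U) (𝔬.Dvstar U) R₀ H₀ CP δP)
    (hR : 𝔬.R U = ϱ • (LinearMap.id - P U))
    (hp45 : HasMaj (bHZKP (κ := κ) i b g (R := R₀) (H := H₀) (s := s) hs0.le hs1.le) (cNormR R₀ H₀ 𝔭.blkPX hG.lenle (βH - 1))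
      (𝔭.ΦX U βH ∘ₗ (𝔬.Dv U ∘ₗ Gp U ∘ₗ 𝔬.Dvstar U)) (fun a b => B45 * Real.exp (-(δ45 * (geo9K i).dist a b))))
    (hpDG : HasMaj (cNormR R₀ H₀ 𝔬.blkW hG.lenle 0) (cNormR R₀ H₀ 𝔭.blkPX hG.lenle (βH - 1)) (𝔭.ΦX U βH ∘ₗ 𝔬.Dv U ∘ₗ Gp U)
      (fun a b => Bh * Real.exp (-(δh * (geo9K i).dist a b))))
    (hϱ : 0 ≤ ϱ) (hCP : 0 ≤ CP) (hB45 : 0 ≤ B45) (hBh : 0 ≤ Bh) (hc : 0 ≤ c) (hσ : 0 ≤ σ)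
    (hδP : δ ≤ δP) (hbud : 0 ≤ δ - α * δ - 2 * σ) (hδ45 : δ - α * δ - 2 * σ ≤ δ45) (hδh : δ - α * δ - σ ≤ δh)
    (hBx : ϱ * ((w s)⁻¹ * B45 + Bh * (CP * L₀) * ((w s)⁻¹ * ((((ℓ + 1 : ℕ) : ℝ)) * Real.exp ((δ - α * δ - σ) * (rNear d ℓ + 1)))) * c * c) ≤ Bx)
    (hδ₃ : δ₃ ≤ δ - α * δ - 2 * σ) :
    HasMaj (bHZKPG (κ := κ) i b g (R := R₀) (H := H₀) w hw0 hw1) (cNormR R₀ H₀ 𝔭.blkPX hG.lenle (βH - 1))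
      (𝔭.ΦX U βH ∘ₗ (𝔬.Dv U ∘ₗ Gp U ∘ₗ 𝔬.R U ∘ₗ 𝔬.Dvstar U)) (fun a b => Bx * Real.exp (-(δ₃ * (geo9K i).dist a b))) := by
  have hws' : 0 ≤ (w s)⁻¹ := inv_nonneg.2 (hw0 s)
  have hρ₁ : 0 ≤ δ - α * δ - σ := by linarith
  have hX := hX_bHZKPG_blk i b g (R₀ := R₀) (H₀ := H₀) hG w hw0 hw1 hs0 hs1 hws hβ1 hlev hbI0 hcfk hblk hρ₁
  have hp45' : HasMaj (bHZKPG (κ := κ) i b g (R := R₀) (H := H₀) w hw0 hw1) (cNormR R₀ H₀ 𝔭.blkPX hG.lenle (βH - 1))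
      (𝔭.ΦX U βH ∘ₗ (𝔬.Dv U ∘ₗ Gp U ∘ₗ 𝔬.Dvstar U)) (fun a b => (w s)⁻¹ * B45 * Real.exp (-(δ45 * (geo9K i).dist a b))) :=
    (hasMaj_from_bHZKPG i b g w hw0 hw1 hs0 hs1 hws (fun _ _ => mul_nonneg hB45 (Real.exp_nonneg _)) hp45).mono
      fun a b => le_of_eq (by ring)
  exact pWE_of_p45Gp hG hF hrow 𝔭 h49 hR hX hp45' hpDG hϱ hCP (by positivity) (mul_nonneg hws' hB45) hBh hc hσ hδP hbud le_rfl hδ45 hδh hBx hδ₃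

/-! ## §3 ★★ The whole record `Letters313Zc` at the graded print-weighted pin -/

/-- ★★ **THE RE-CUT RECORD `Letters313Zc` AT THE PIN `bXH := bHZKPG g w` FROM THE `bXH`-FREE RECORD `Letters313Z` AND PRINTED-SPECIES MEMBERS** (`Letters313Zc.of_Z`
with `gXH := gXH_bHZKPG_of_pins`, `wGp := wGp_bHZKPG_of_pins`): the certificate's displayed `hletters13` at the option-(2) pin reduces to `Letters313Z` + (3.44) for G′ at
`bHZKP g s` + (3.42)₃ `he2` ∕ ∀s (3.43)₂ `h43 s` for G₀ + the steps `hK ∕ hpX s` + `Identities` + the pin equations; the record's constants `B₃ δ₃` must dominate both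
derived members (`hB₃w hB₃g hδ₃w hδ₃g`). [cite: Balaban1985BackgroundPropagators, Thm 3.13 p.426 + Thm 3.12 p.423 + (3.42)–(3.45) pp.397–398 + (3.49) p.399 + (3.152)–(3.153) p.426; Balaban1984PropagatorsII, (2.51)–(2.56) pp.232–233 + Lemma 2.1 (2.60)–(2.61) p.234] -/
theorem letters313Zc_bHZKPG_of_pins (hG : GeoOK (geo9K i)) {dF : ℕ} {δ α L₀ σ c : ℝ} (hF : Facts347 (geo9K i) R₀ H₀ dF δ α L₀)
    (hrow : RowSum (toB6 (geo9K i) R₀ H₀) σ c) {𝔬 : Ops (geo9K i) B (XBK κ i) Y Z W}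
    (𝔭 : HolderProbes (geo9K i) B (XBK κ i) Y (PK (FBondY i) (Fin (d + 1)) κ) PY) {Gp P : B.Cfg → Module.End ℝ (W → ℝ)} {U : B.Cfg}
    {wZ : (geo9K i).Site → ℝ} {hwZ : ∀ y, 0 < wZ y} {B₃ δ₃ : ℝ} (hL : Letters313Z 𝔬 R₀ H₀ hG wZ hwZ B₃ δ₃ U)
    (w : ℝ → ℝ) (hw0 : ∀ s, 0 ≤ w s) (hw1 : ∀ s, w s ≤ 1) {s : ℝ} (hs0 : 0 < s) (hs1 : s < 1) (hws : 0 < w s)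
    {bI : FBondY i → IBondY i}
    (hβ1 : ∀ f : FBondY i, (geomT i.D).dist (β i.hN i.D i.hk (bI f)) (blkV1 i.hN i.D f) ≤ 1)
    (hlev : ∀ f : FBondY i, lvl i.hN i.D i.hk (bI f) = (blkV1 i.hN i.D f).1.1) (hbI0 : ∀ f : FBondY i, bI f = bI ⟨f.src, 0⟩)
    (hcfk : i.cf = (((ℓ + 1 : ℕ) : ℝ)) ^ i.k) (hblk : 𝔬.blk = blkBK i bI) (hPX : 𝔭.blkPX = blkPK bI)
    (hΦ : ∀ s, 0 < s → s < 1 → 𝔭.ΦX U s = probeK b g (wKA i s) (w₀K i s))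
    -- the `wGp` data ((3.44) for G′ at the transported member, Thm 3.1, (3.49), R = ϱ(I − P))
    {B₀ δ₀ CP δP B44 δ44 ϱ : ℝ}
    (h31 : Thm31GpMaj 𝔬.blkW 𝔬.blk (Gp U) (𝔬.Dv U) (𝔬.Dvstar U) R₀ H₀ B₀ δ₀)
    (h49 : Proj349Maj 𝔬.blkW 𝔬.blk (P U) (𝔬.Dv U) (𝔬.Dvstar U) R₀ H₀ CP δP)
    (hR : 𝔬.R U = ϱ • (LinearMap.id - P U))
    (h44 : HasMaj (bHZKP (κ := κ) i b g (R := R₀) (H := H₀) (s := s) hs0.le hs1.le) (cNorm R₀ H₀ 𝔬.blk hG.lenle 1) (𝔬.Dv U ∘ₗ Gp U ∘ₗ 𝔬.Dvstar U)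
      (fun a b => B44 * Real.exp (-(δ44 * (geo9K i).dist a b))))
    (hϱ : 0 ≤ ϱ) (hB₀ : 0 ≤ B₀) (hCP : 0 ≤ CP) (hB44 : 0 ≤ B44) (hc : 0 ≤ c) (hσ : 0 ≤ σ) (hαδ : 0 ≤ α * δ)
    (hδ₀ : δ ≤ δ₀) (hδP : δ ≤ δP) (hbud : 0 ≤ δ - α * δ - 2 * σ) (hδ44 : δ - α * δ - 2 * σ ≤ δ44)
    (hB₃w : ϱ * ((w s)⁻¹ * B44 + B₀ * (CP * L₀) * ((w s)⁻¹ * ((((ℓ + 1 : ℕ) : ℝ)) * Real.exp ((δ - α * δ - σ) * (rNear d ℓ + 1)))) * c * c) ≤ B₃)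
    (hδ₃w : δ₃ ≤ δ - α * δ - 2 * σ)
    -- the `gXH` data ((3.42)₃ and ∀s (3.43)₂ for G₀, the steps, the identities)
    {θ B₀' δ₀' δK ρ BH : ℝ} {θH Bh : ℝ → ℝ}
    (hθ : 0 ≤ θ) (hθH : ∀ s, 0 < s → s < 1 → 0 ≤ θH s) (hB₀' : 0 ≤ B₀') (hBh : ∀ s, 0 < s → s < 1 → 0 ≤ Bh s) (hBH : 0 ≤ BH)
    (hρ : 0 ≤ ρ) (hρS : ρ ≤ δ₀') (hρδ : ρ + σ ≤ δK) (hq : θ * c < 1)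
    (hwB : ∀ s, 0 < s → s < 1 → w s * (Bh s + θH s * (B₀' * (1 - θ * c)⁻¹) * c) ≤ BH)
    (hK : HasMaj (cNorm R₀ H₀ 𝔬.blk hG.lenle 1) (cNorm R₀ H₀ 𝔬.blk hG.lenle 1) (𝔬.G0 U ∘ₗ (𝔬.Tpi U + 𝔬.T2 U))
      (fun a b => θ * Real.exp (-(δK * (geo9K i).dist a b))))
    (he2 : HasMajorantHom (g := toB6 (geo9K i) R₀ H₀) 𝔬.blkY 𝔬.blk (𝔬.G0 U ∘ₗ 𝔬.Dstar U)
      (fun a b => B₀' * (geo9K i).len a * Real.exp (-(δ₀' * (geo9K i).dist a b))))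
    (h43 : ∀ s, 0 < s → s < 1 → HasMajorantHom (g := toB6 (geo9K i) R₀ H₀) 𝔬.blkY 𝔭.blkPX (𝔭.ΦX U s ∘ₗ (𝔬.G0 U ∘ₗ 𝔬.Dstar U))
      (fun (a b : (geo9K i).Site) => Bh s * (geo9K i).len a ^ (1 - s) * Real.exp (-(δ₀' * (geo9K i).dist a b))))
    (hpX : ∀ s, 0 < s → s < 1 → HasMaj (cNormR R₀ H₀ 𝔬.blk hG.lenle (-1)) (cNormR R₀ H₀ 𝔭.blkPX hG.lenle (s - 1))
      ((𝔭.ΦX U s ∘ₗ 𝔬.G0 U) ∘ₗ (𝔬.Tpi U + 𝔬.T2 U)) (fun a b => θH s * Real.exp (-(δK * (geo9K i).dist a b))))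
    (hI : Identities 𝔬 U)
    (hB₃g : (((ℓ + 1 : ℕ) : ℝ)) * Real.exp (ρ * (rNear d ℓ + 1)) * (B₀' * (1 - θ * c)⁻¹ + BH) ≤ B₃) (hδ₃g : δ₃ ≤ ρ) :
    Letters313Zc 𝔬 Gp R₀ H₀ hG wZ hwZ B₃ δ₃ (bHZKPG (κ := κ) i b g (R := R₀) (H := H₀) w hw0 hw1) U :=
  Letters313Zc.of_Z hL
    (gXH_bHZKPG_of_pins i b g hG hrow 𝔭 w hw0 hw1 hc hθ hθH hB₀' hBh hBH hρ hρS hρδ hq hwB hβ1 hlev hbI0 hcfk hblk hPX hΦ hK he2 h43 hpX hI hB₃g hδ₃g)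
    (wGp_bHZKPG_of_pins i b g hG hF hrow w hw0 hw1 hs0 hs1 hws hβ1 hlev hbI0 hcfk hblk h31 h49 hR h44 hϱ hB₀ hCP hB44 hc hσ hαδ hδ₀ hδP hbud hδ44 hB₃w hδ₃w)

end

end Literature.MathematicalPhysics.QuantumFieldTheory.Balaban1983to89.B9Thm313WholeCutLettersAtPinsP
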